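import Summits.PneNP.PneNP.Theses.RootDecompParityMagnification
import Literature.Computability.MetaComplexity.AtseriasMuller2025.UniformMagnification
import Literature.Computability.Complexity.UniformCircuitClassesWiresInhabited

/-!
# `RootDecompParityMagnification.UniformClassInhabitedAM` (stmt-PneNP-31124) — the vacuity guard

Node N30 of the decomp-pnenp root-decomposition cell (route `route-PneNP-RootDecompParityMagnification`)
records, as an aside, that the typed uniform class of its cut predicate is INHABITED: the HEAD promise
problem `⟨HeadLang, HeadLangᶜ⟩` lies in `P-uniform-SIZE[⌈N^{1+1/100+1/100}⌉]`, decided by the tree's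
DLOGTIME-uniform one-gate family `headFamily` (`UniformCircuitClassesWiresInhabited`,
`headFamily_isDLogTimeUniform`, `headFamily_bounds`, `headFamily_decides`) of size `1`, with
`DTIME(n) ⊆ E` and fan-in `min n 1 ≤ 2` (`B₂`).  So Atserias–Müller's hypothesis `HypothesisU ε δ s`
is not true for want of uniform families (census caveat hU / test T_U discharged).  Verbatim port of the
cell critic's kernel block §CriticL1g8 (L1_ParityMagnification_g8_probe.lean 3d14a880; re-certified in
Anchor_N30_ParityMagnification.lean 0487edf2, 2026-08-30T08:49:16Z: `tree_uniformClassInhabitedAM_holds :=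
CriticL1g8.head_mem_PUniformSIZE_thresholdU (by norm_num)`).  0 sorry.
-/

namespace Summit.PneNP.PneNP.Theorems

open Literature.Computability.Complexity
open Literature.Computability.MetaComplexity.AtseriasMuller2025

/-- `DTIME(n) ⊆ E` (linear time is inside `⋃_c DTIME(2^{cn})`). Port of critic §CriticL1g8
(decomp-pnenp cell, 2026-08-30). [folklore] -/
private theorem DTIME_lin_subset_E' : DTIME (fun n => n) ⊆ E := by
  intro L hL
  refine Set.mem_iUnion.2 ⟨1, DTIME_mono (fun n => ?_) hL⟩
  rw [one_mul]
  exact Nat.lt_two_pow_self.le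

/-- The head family is `E`-DC-uniform (it is DLOGTIME-uniform). Port of critic §CriticL1g8. [folklore] -/
private theorem headFamily_isDCUniform_E' : headFamily.IsDCUniform E :=
  headFamily_isDLogTimeUniform.mono DTIME_lin_subset_E'

/-- The gates of the head circuit are binary-basis gates (fan-in `min n 1 ≤ 2`). Port of critic
§CriticL1g8. [folklore] -/
private theorem headCircuit_isOver_B2' (n : ℕ) : (headCircuit n).IsOver B2 := by
  intro g hg
  have hg' : g = headGate n := by simpa [headCircuit] using hg
  subst hg'
  show (headGate n).fn ∈ B2
  rw [headGate_fn]
  show (GateFn.and (min n 1)).1 ≤ 2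
  simp only [GateFn.and]
  omega

/-- Non-vacuity of AM25's typed uniform class: the HEAD promise problem lies in `P-uniform-SIZE[1]`.
Port of critic §CriticL1g8 `head_mem_PUniformSIZE`. [folklore] -/
private theorem head_mem_PUniformSIZE_one :
    (⟨HeadLang, HeadLangᶜ⟩ : PromiseProblem) ∈ PUniformSIZE fun _ => 1 := by
  refine ⟨headFamily, 0, fun n _ => ⟨headCircuit_isOver_B2' n, (headFamily_bounds n).2.2.1⟩,
    headFamily_isDCUniform_E', fun x _ => ⟨fun hx => ?_, fun hx => ?_⟩⟩
  · have h := headFamily_decides x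
    have hx' : x ∈ HeadLang := hx
    rw [h]
    exact (Set.mem_iff_boolIndicator _ _).1 hx'
  · have h := headFamily_decides x
    have hx' : x ∉ HeadLang := hx
    rw [h]
    exact (Set.notMem_iff_boolIndicator _ _).1 hx'

/-- The same for every eventually-positive size bound. Port of critic §CriticL1g8. [folklore] -/
private theorem head_mem_PUniformSIZE_of_pos' {t : ℕ → ℕ} (ht : ∃ n₁, ∀ n ≥ n₁, 1 ≤ t n) :
    (⟨HeadLang, HeadLangᶜ⟩ : PromiseProblem) ∈ PUniformSIZE t :=
  PUniformSIZE_mono ht head_mem_PUniformSIZE_one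

/-- In particular for AM25's threshold `⌈n^{1+ε+δ}⌉₊` (which is `≥ 1` for `n ≥ 1` when the exponent is
positive). Port of critic §CriticL1g8 `head_mem_PUniformSIZE_thresholdU`. [folklore] -/
private theorem head_mem_PUniformSIZE_thresholdU' {ε δ : ℝ} (h : 0 < 1 + ε + δ) :
    (⟨HeadLang, HeadLangᶜ⟩ : PromiseProblem) ∈ PUniformSIZE (thresholdU ε δ) := by
  refine head_mem_PUniformSIZE_of_pos' ⟨1, fun n hn => ?_⟩
  unfold thresholdU
  have : (1 : ℝ) ≤ (n : ℝ) ^ (1 + ε + δ) := by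
    have hn' : (1 : ℝ) ≤ n := by exact_mod_cast hn
    exact Real.one_le_rpow hn' h.le
  exact Nat.one_le_ceil_iff.mpr (lt_of_lt_of_le zero_lt_one this) |>.trans' le_rfl

/-- `UniformClassInhabitedAM` (stmt-PneNP-31124): `⟨HeadLang, HeadLangᶜ⟩ ∈ PUniformSIZE (thresholdU (1/100)
(1/100))` — the typed class `P-uniform-SIZE[⌈N^{1.02}⌉]` of node N30's cut predicate is inhabited, by the
tree's DLOGTIME-uniform head family (decomp-pnenp cell; port of the critic-certified term
`CriticL1g8.head_mem_PUniformSIZE_thresholdU (by norm_num)`, 2026-08-30). -/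
theorem uniformClassInhabitedAM_proof :
    Summit.PneNP.PneNP.Theses.RootDecompParityMagnification.UniformClassInhabitedAM := by
  unfold Summit.PneNP.PneNP.Theses.RootDecompParityMagnification.UniformClassInhabitedAM
  exact head_mem_PUniformSIZE_thresholdU' (by norm_num)

end Summit.PneNP.PneNP.Theorems
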